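import Mathlib
import Summits.PneNP.PneNP.Theorems.OverlapGapAlgebraSolvableImpliesStableSectionRepairClauseFibre

/-!
# PneNP / OverlapGapAlgebra — crux `SolvableImpliesStableSection` (stmt-PneNP-2463):
# the FILTERED REPAIR block (2/6) — clause-fibre counts

Support for crux `stmt-PneNP-2463` (`Summit.PneNP.PneNP.Theses.OverlapGapAlgebra.SolvableImpliesStableSection`).
Counting clause contents `c : Fin k → Fin n × Bool` (literal = (variable, sign), sign `false` =
negative).  `c` is CRITICAL for `v` when it has a negative literal and all its negative literals sit on
`v`.  The counts feeding the mean bound of the filtered repair round (`…FilteredRepairMean`):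

* `sissF_card_firstVar_allPos_le` — contents that are all-positive with first variable `u`: `≤ n^{k-1}`;
* `sissF_card_crit_ge` / `sissF_card_crit_le` — contents critical for `v`: between `k n^{k-1}` and
  `k (n+1)^{k-1}`;
* `sissF_card_notCrit_add_le` — contents critical for none of `t` distinct variables: at most
  `(2n)^k - t k n^{k-1}`;
* `sissF_fibreA_le` — all-positive contents with first variable in `U`: `≤ |U| n^{k-1}`;
* `sissF_fibreB_le` — contents whose negative literals all sit on `S`, two of them on distinct
  variables: `≤ C(k,2) |S|² (n + |S|)^{k-2}`.
No new definitions; axioms `propext`, `Classical.choice`, `Quot.sound`.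
-/

set_option linter.dupNamespace false -- `Summit.PneNP.PneNP.…`: summit = sub-problem (D-0017)

namespace Summit.PneNP.PneNP.Theorems

open Finset
open scoped Classical

section FilteredRepairFibre

variable {k n : ℕ}

/-- All-positive contents with a prescribed first variable: at most `n^{k-1}` of them. -/
theorem sissF_card_firstVar_allPos_le (hk : 0 < k) (u : Fin n) :
    ((univ : Finset (Fin k → Fin n × Bool)).filter fun c =>
        (c ⟨0, hk⟩).1 = u ∧ ∀ j, (c j).2 = true).card ≤ n ^ (k - 1) := by
  set t : Fin k → Finset (Fin n × Bool) := fun j =>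
    if j = ⟨0, hk⟩ then {(u, true)} else univ.filter fun ℓ => ℓ.2 = true with ht
  have hsub : ((univ : Finset (Fin k → Fin n × Bool)).filter fun c =>
      (c ⟨0, hk⟩).1 = u ∧ ∀ j, (c j).2 = true) ⊆ Fintype.piFinset t := by
    intro c hc
    simp only [mem_filter, mem_univ, true_and] at hc
    rw [Fintype.mem_piFinset]
    intro j
    simp only [ht]
    split_ifs with hj
    · rw [mem_singleton, hj, Prod.ext_iff]
      exact ⟨hc.1, hc.2 _⟩
    · simp only [mem_filter, mem_univ, true_and]
      exact hc.2 j
  refine (card_le_card hsub).trans ?_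
  rw [Fintype.card_piFinset]
  have hsplit := Finset.mul_prod_erase (univ : Finset (Fin k)) (fun j => (t j).card)
    (mem_univ ⟨0, hk⟩)
  rw [← hsplit]
  have h0 : (t ⟨0, hk⟩).card = 1 := by simp [ht]
  have hrest : ∀ j ∈ (univ : Finset (Fin k)).erase ⟨0, hk⟩, (t j).card = n := by
    intro j hj
    have hj' : j ≠ ⟨0, hk⟩ := (mem_erase.1 hj).1
    simp only [ht, if_neg hj']
    exact Summit.PneNP.PneNP.Cruxes.SolvableImpliesStableSection.Sketch.repairClauseFibre_posLiterals_card n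
  rw [h0, one_mul, prod_congr rfl hrest, prod_const, card_erase_of_mem (mem_univ _), card_univ,
    Fintype.card_fin]

/-- Contents critical for `v`: at least `k n^{k-1}` of them (one negative literal `(v, false)` at a
chosen position, positive literals elsewhere). -/
theorem sissF_card_crit_ge (v : Fin n) :
    k * n ^ (k - 1) ≤ ((univ : Finset (Fin k → Fin n × Bool)).filter fun c =>
        (∃ j, (c j).2 = false) ∧ ∀ j, (c j).2 = false → (c j).1 = v).card := by
  -- the family `A j` = contents with `(v, false)` at `j` and positive literals elsewhere
  set A : Fin k → Finset (Fin k → Fin n × Bool) := fun j =>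
    Fintype.piFinset fun l => if l = j then {(v, false)} else univ.filter fun ℓ => ℓ.2 = true with hA
  have hmemA : ∀ j c, c ∈ A j ↔ c j = (v, false) ∧ ∀ l, l ≠ j → (c l).2 = true := by
    intro j c
    rw [hA, Fintype.mem_piFinset]
    constructor
    · intro h
      refine ⟨?_, fun l hl => ?_⟩
      · have := h j
        simpa using this
      · have := h l
        rw [if_neg hl] at this
        simpa using this
    · rintro ⟨h1, h2⟩ l
      by_cases hl : l = j
      · subst hl; simp [h1]
      · rw [if_neg hl]; simpa using h2 l hl
  have hcardA : ∀ j, (A j).card = n ^ (k - 1) := by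
    intro j
    rw [hA, Fintype.card_piFinset, ← Finset.mul_prod_erase univ _ (mem_univ j)]
    simp only [if_true]
    rw [card_singleton, one_mul]
    have hrest : ∀ l ∈ (univ : Finset (Fin k)).erase j,
        (if l = j then ({(v, false)} : Finset (Fin n × Bool))
          else univ.filter fun ℓ : Fin n × Bool => ℓ.2 = true).card = n := by
      intro l hl
      rw [if_neg (mem_erase.1 hl).1]
      exact Summit.PneNP.PneNP.Cruxes.SolvableImpliesStableSection.Sketch.repairClauseFibre_posLiterals_card n
    rw [prod_congr rfl hrest, prod_const, card_erase_of_mem (mem_univ _), card_univ, Fintype.card_fin]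
  have hdisj : ∀ j ∈ (univ : Finset (Fin k)), ∀ j' ∈ (univ : Finset (Fin k)), j ≠ j' →
      Disjoint (A j) (A j') := by
    intro j _ j' _ hjj'
    rw [Finset.disjoint_left]
    intro c hc hc'
    rw [hmemA] at hc hc'
    have h1 := hc'.2 j hjj'
    rw [hc.1] at h1
    exact Bool.false_ne_true h1
  have hsub : (univ : Finset (Fin k)).biUnion A ⊆ (univ : Finset (Fin k → Fin n × Bool)).filter fun c =>
      (∃ j, (c j).2 = false) ∧ ∀ j, (c j).2 = false → (c j).1 = v := by
    intro c hc
    rw [mem_biUnion] at hc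
    obtain ⟨j, -, hc⟩ := hc
    rw [hmemA] at hc
    simp only [mem_filter, mem_univ, true_and]
    refine ⟨⟨j, by rw [hc.1]⟩, fun l hl => ?_⟩
    by_cases hlj : l = j
    · rw [hlj, hc.1]
    · have := hc.2 l hlj
      rw [hl] at this
      exact absurd this Bool.false_ne_true
  calc k * n ^ (k - 1) = ∑ j : Fin k, (A j).card := by
        rw [Finset.sum_congr rfl fun j _ => hcardA j, sum_const, card_univ, Fintype.card_fin,
          smul_eq_mul]
    _ = ((univ : Finset (Fin k)).biUnion A).card := (card_biUnion hdisj).symm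
    _ ≤ _ := card_le_card hsub

/-- The literal set "positive, or the negative literal on `v`" has `n + 1` elements. -/
theorem sissF_critLiterals_card (v : Fin n) :
    ((univ : Finset (Fin n × Bool)).filter fun ℓ => ℓ.2 = true ∨ ℓ = (v, false)).card = n + 1 := by
  have h : ((univ : Finset (Fin n × Bool)).filter fun ℓ => ℓ.2 = true ∨ ℓ = (v, false))
      = insert (v, false) (univ.filter fun ℓ : Fin n × Bool => ℓ.2 = true) := by
    ext ⟨w, s⟩
    cases s <;> simp [Prod.ext_iff]
  rw [h, card_insert_of_notMem (by simp),
    Summit.PneNP.PneNP.Cruxes.SolvableImpliesStableSection.Sketch.repairClauseFibre_posLiterals_card]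

/-- Contents critical for `v`: at most `k (n+1)^{k-1}` of them (some position carries `(v, false)`, the
others a positive literal or `(v, false)`). -/
theorem sissF_card_crit_le (v : Fin n) :
    ((univ : Finset (Fin k → Fin n × Bool)).filter fun c =>
        (∃ j, (c j).2 = false) ∧ ∀ j, (c j).2 = false → (c j).1 = v).card ≤ k * (n + 1) ^ (k - 1) := by
  set B : Fin k → Finset (Fin k → Fin n × Bool) := fun j =>
    Fintype.piFinset fun l => if l = j then {(v, false)}
      else univ.filter fun ℓ : Fin n × Bool => ℓ.2 = true ∨ ℓ = (v, false) with hB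
  have hsub : ((univ : Finset (Fin k → Fin n × Bool)).filter fun c =>
      (∃ j, (c j).2 = false) ∧ ∀ j, (c j).2 = false → (c j).1 = v) ⊆ (univ : Finset (Fin k)).biUnion B := by
    intro c hc
    simp only [mem_filter, mem_univ, true_and] at hc
    obtain ⟨⟨j, hj⟩, hall⟩ := hc
    rw [mem_biUnion]
    refine ⟨j, mem_univ _, ?_⟩
    rw [hB, Fintype.mem_piFinset]
    intro l
    by_cases hlj : l = j
    · subst hlj
      rw [if_pos rfl, mem_singleton, Prod.ext_iff]
      exact ⟨hall _ hj, hj⟩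
    · rw [if_neg hlj]
      simp only [mem_filter, mem_univ, true_and]
      cases hs : (c l).2
      · right
        rw [Prod.ext_iff]
        exact ⟨hall _ hs, hs⟩
      · left; rfl
  have hcardB : ∀ j, (B j).card = (n + 1) ^ (k - 1) := by
    intro j
    rw [hB, Fintype.card_piFinset, ← Finset.mul_prod_erase univ _ (mem_univ j)]
    simp only [if_true]
    rw [card_singleton, one_mul]
    have hrest : ∀ l ∈ (univ : Finset (Fin k)).erase j,
        (if l = j then ({(v, false)} : Finset (Fin n × Bool))
          else univ.filter fun ℓ : Fin n × Bool => ℓ.2 = true ∨ ℓ = (v, false)).card = n + 1 := by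
      intro l hl
      rw [if_neg (mem_erase.1 hl).1]
      exact sissF_critLiterals_card v
    rw [prod_congr rfl hrest, prod_const, card_erase_of_mem (mem_univ _), card_univ, Fintype.card_fin]
  calc _ ≤ ((univ : Finset (Fin k)).biUnion B).card := card_le_card hsub
    _ ≤ ∑ j : Fin k, (B j).card := card_biUnion_le
    _ = k * (n + 1) ^ (k - 1) := by
        rw [Finset.sum_congr rfl fun j _ => hcardB j, sum_const, card_univ, Fintype.card_fin,
          smul_eq_mul]

/-- Contents critical for none of `t` distinct variables: together with the `t` pairwise disjoint
critical classes (each of size `≥ k n^{k-1}`) they fit into all `(2n)^k` contents. -/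
theorem sissF_card_notCrit_add_le {t : ℕ} (u : Fin t → Fin n) (hu : Function.Injective u) :
    ((univ : Finset (Fin k → Fin n × Bool)).filter fun c =>
        ∀ l, ¬ ((∃ j, (c j).2 = false) ∧ ∀ j, (c j).2 = false → (c j).1 = u l)).card
      + t * (k * n ^ (k - 1)) ≤ (2 * n) ^ k := by
  set Cr : Fin t → Finset (Fin k → Fin n × Bool) := fun l => univ.filter fun c =>
    (∃ j, (c j).2 = false) ∧ ∀ j, (c j).2 = false → (c j).1 = u l with hCr
  set Nc : Finset (Fin k → Fin n × Bool) := univ.filter fun c =>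
    ∀ l, ¬ ((∃ j, (c j).2 = false) ∧ ∀ j, (c j).2 = false → (c j).1 = u l) with hNc
  have hdisj : ∀ l ∈ (univ : Finset (Fin t)), ∀ l' ∈ (univ : Finset (Fin t)), l ≠ l' →
      Disjoint (Cr l) (Cr l') := by
    intro l _ l' _ hll'
    rw [Finset.disjoint_left]
    intro c hc hc'
    simp only [hCr, mem_filter, mem_univ, true_and] at hc hc'
    obtain ⟨⟨j, hj⟩, hc⟩ := hc
    exact hll' (hu ((hc j hj).symm.trans (hc'.2 j hj)))
  have hUcard : ((univ : Finset (Fin t)).biUnion Cr).card = ∑ l, (Cr l).card := card_biUnion hdisj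
  have hdisj2 : Disjoint Nc ((univ : Finset (Fin t)).biUnion Cr) := by
    rw [Finset.disjoint_left]
    intro c hc hc'
    rw [mem_biUnion] at hc'
    obtain ⟨l, -, hc'⟩ := hc'
    simp only [hNc, hCr, mem_filter, mem_univ, true_and] at hc hc'
    exact hc l hc'
  have h1 : (Nc ∪ (univ : Finset (Fin t)).biUnion Cr).card ≤ (2 * n) ^ k := by
    refine (card_le_univ _).trans ?_
    rw [Fintype.card_fun, Fintype.card_prod, Fintype.card_fin, Fintype.card_fin, Fintype.card_bool]
    ring_nf
    exact le_rfl
  rw [card_union_of_disjoint hdisj2, hUcard] at h1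
  have h2 : t * (k * n ^ (k - 1)) ≤ ∑ l : Fin t, (Cr l).card := by
    calc t * (k * n ^ (k - 1)) = ∑ _l : Fin t, k * n ^ (k - 1) := by
          rw [sum_const, card_univ, Fintype.card_fin, smul_eq_mul]
      _ ≤ ∑ l : Fin t, (Cr l).card := sum_le_sum fun l _ => sissF_card_crit_ge (u l)
  omega

/-- **Fibre A.** All-positive contents whose first variable lies in `U`: at most `|U| n^{k-1}`. -/
theorem sissF_fibreA_le (hk : 0 < k) (U : Finset (Fin n)) :
    ((univ : Finset (Fin k → Fin n × Bool)).filter fun c =>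
        (∀ j, (c j).2 = true) ∧ (c ⟨0, hk⟩).1 ∈ U).card ≤ U.card * n ^ (k - 1) := by
  have hsub : ((univ : Finset (Fin k → Fin n × Bool)).filter fun c =>
      (∀ j, (c j).2 = true) ∧ (c ⟨0, hk⟩).1 ∈ U) ⊆ U.biUnion fun u =>
        (univ : Finset (Fin k → Fin n × Bool)).filter fun c =>
          (c ⟨0, hk⟩).1 = u ∧ ∀ j, (c j).2 = true := by
    intro c hc
    simp only [mem_filter, mem_univ, true_and] at hc
    rw [mem_biUnion]
    exact ⟨_, hc.2, by rw [mem_filter]; exact ⟨mem_univ _, rfl, hc.1⟩⟩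
  calc _ ≤ _ := card_le_card hsub
    _ ≤ ∑ u ∈ U, ((univ : Finset (Fin k → Fin n × Bool)).filter fun c =>
          (c ⟨0, hk⟩).1 = u ∧ ∀ j, (c j).2 = true).card := card_biUnion_le
    _ ≤ ∑ _u ∈ U, n ^ (k - 1) := sum_le_sum fun u _ => sissF_card_firstVar_allPos_le hk u
    _ = U.card * n ^ (k - 1) := by rw [sum_const, smul_eq_mul]

/-- **Fibre B.** Contents all of whose negative literals sit on variables of `S`, two of them on distinct
variables: at most `C(k,2) · |S|² (n + |S|)^{k-2}` (choose the two positions; they carry negative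
literals on `S`, the other positions a positive literal or a negative literal on `S`). -/
theorem sissF_fibreB_le {k n : ℕ} (S : Finset (Fin n)) :
    ((univ : Finset (Fin k → Fin n × Bool)).filter fun c =>
        (∀ j, (c j).2 = false → (c j).1 ∈ S) ∧
        ∃ j j', (c j).2 = false ∧ (c j').2 = false ∧ (c j).1 ≠ (c j').1).card
      ≤ k.choose 2 * (S.card ^ 2 * (n + S.card) ^ (k - 2)) := by
  -- admissible literals: positive, or negative on `S` (`n + |S|` of them); negative on `S` (`|S|`)
  set L : Finset (Fin n × Bool) := univ.filter fun ℓ => ℓ.2 = false → ℓ.1 ∈ S with hL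
  set M : Finset (Fin n × Bool) := S ×ˢ {false} with hM
  have hLcard : L.card = n + S.card :=
    Summit.PneNP.PneNP.Cruxes.SolvableImpliesStableSection.Sketch.repairClauseFibre_literals_card n S
  have hMcard : M.card = S.card := by rw [hM, card_product, card_singleton, mul_one]
  -- for a 2-set `A` of positions, the box `T A`
  set T : Finset (Fin k) → Finset (Fin k → Fin n × Bool) := fun A =>
    Fintype.piFinset fun l => if l ∈ A then M else L with hT
  have hTcard : ∀ A ∈ (univ : Finset (Fin k)).powersetCard 2,
      (T A).card = S.card ^ 2 * (n + S.card) ^ (k - 2) := by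
    intro A hA
    rw [mem_powersetCard] at hA
    rw [hT, Fintype.card_piFinset]
    rw [show (∏ l : Fin k, (if l ∈ A then M else L).card)
        = ∏ l : Fin k, (if l ∈ A then M.card else L.card) from
          prod_congr rfl fun l _ => by split_ifs <;> rfl]
    rw [prod_ite, prod_const, prod_const, hMcard, hLcard]
    have hf1 : ((univ : Finset (Fin k)).filter fun l => l ∈ A) = A := by
      ext l; simp
    have hf2 : ((univ : Finset (Fin k)).filter fun l => ¬ l ∈ A).card = k - 2 := by
      have := Finset.card_filter_add_card_filter_not (s := (univ : Finset (Fin k))) (fun l => l ∈ A)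
      rw [hf1, hA.2, card_univ, Fintype.card_fin] at this
      omega
    rw [hf1, hA.2, hf2]
  have hsub : ((univ : Finset (Fin k → Fin n × Bool)).filter fun c =>
      (∀ j, (c j).2 = false → (c j).1 ∈ S) ∧
        ∃ j j', (c j).2 = false ∧ (c j').2 = false ∧ (c j).1 ≠ (c j').1)
      ⊆ ((univ : Finset (Fin k)).powersetCard 2).biUnion T := by
    intro c hc
    simp only [mem_filter, mem_univ, true_and] at hc
    obtain ⟨hall, j, j', hj, hj', hne⟩ := hc
    have hjj' : j ≠ j' := by
      rintro rfl
      exact hne rfl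
    rw [mem_biUnion]
    refine ⟨{j, j'}, ?_, ?_⟩
    · rw [mem_powersetCard]
      exact ⟨subset_univ _, card_pair hjj'⟩
    · rw [hT, Fintype.mem_piFinset]
      intro l
      by_cases hl : l ∈ ({j, j'} : Finset (Fin k))
      · rw [if_pos hl, hM, mem_product, mem_singleton]
        rw [mem_insert, mem_singleton] at hl
        rcases hl with rfl | rfl
        · exact ⟨hall _ hj, hj⟩
        · exact ⟨hall _ hj', hj'⟩
      · rw [if_neg hl, hL]
        simp only [mem_filter, mem_univ, true_and]
        exact hall l
  calc _ ≤ (((univ : Finset (Fin k)).powersetCard 2).biUnion T).card := card_le_card hsub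
    _ ≤ ∑ A ∈ (univ : Finset (Fin k)).powersetCard 2, (T A).card := card_biUnion_le
    _ = ∑ _A ∈ (univ : Finset (Fin k)).powersetCard 2, S.card ^ 2 * (n + S.card) ^ (k - 2) :=
        sum_congr rfl hTcard
    _ = k.choose 2 * (S.card ^ 2 * (n + S.card) ^ (k - 2)) := by
        rw [sum_const, card_powersetCard, card_univ, Fintype.card_fin, smul_eq_mul]

end FilteredRepairFibre

end Summit.PneNP.PneNP.Theorems
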